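import Mathlib
import HarnessLib
import Literature.MathematicalPhysics.QuantumLattice.HubbardDiagonalQuadraticEffAction
import Summits.HubbardSuperconductivity.HubbardSuperconductivity.Theorems.KLProgrammeKLRegimeTwoVolumeFrameMismatchResum
import Summits.HubbardSuperconductivity.HubbardSuperconductivity.Theorems.KLProgrammeKLRegimeTwoVolumeDualReadoutRows

/-!
# Route `KLProgramme` — crux K3 ENGINE (stmt-HubbardSuperconductivity-20437 `KLRegimeEngineV17F2`), stub (e) proof-input «(e)-D-ROWS», keying (A′) (pen (R495)):
# THE CHAIN PART `effAction_{Ψ}(𝒩_D) − 𝒩_D` OF THE FRAME CONVERSION IS A DIAGONAL QUADRATIC; ITS RAW TWO-LEG POSITION KERNEL AND PINNED ROWS, EXACTLY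
# (cell gate-hubbard-kl, seat hubbard-kl-k3c4-p1 g26, VL lane; memo DROWS-SCOPE-g26.md §14; consumer: the `Pe` rows of `…TwoVolumeDualRowsFrameSplit.hPd_of_commonFrame_add_conversion`)

`…TwoVolumeDualRowsFrameSplit.klEffectiveAction_sub_counterQuadratic_frame_eq` (p732040) writes the one-volume frame conversion of `T(K) − 𝒩_K` as
`(effAction_{Ψ_{K₂}}(𝒩_D) − 𝒩_D) + (dressing/response)`, `D = K₂ ⊖ K₁`.  The first summand — the coefficient-1 mismatch having CANCELLED — is second order in `D`:
by the tree's `effAction_normalCovariance_diagQuadratic` (`HubbardDiagonalQuadraticEffAction`) and `counterQuadratic_eq_sum_smul` it is the DIAGONAL quadratic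
`Σ_{ks} q(ks)·ψ̂⁺_{ks}ψ̂⁻_{ks}`, `q = κ_D/(1 + Ψκ_D) − κ_D = −κ_D²Ψ/(1 + Ψκ_D)`, `κ_D(ks) = D(p_k⃗)/(βL²)`.  This file types that and reads its raw two-leg rows:

* §1 generic diagonal quadratics `Σ_{ks} q ks • (ψ̂⁺_{ks}ψ̂⁻_{ks})`: `kernel_two_diagQuad_string` (the `(+,−)` kernel: `q(k,σ)·(2!)⁻¹` on the diagonal, `0` off it),
  **`dualKernel_two_diagQuad`** (the raw two-leg position kernel `W_σ(x₀,x₁) = Σ_k q(k,σ)(2!)⁻¹·e^{iω_k(t₁−t₀)}χ_{k⃗}(x⃗₁−x⃗₀)`, k3c5-p2's `dualKernel_two_eq_of_diagonal`),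
  **`pinnedRow_two_diagQuad_eq`** (the pinned raw row at `x₀` IS the `ℓ¹` character sum of the symbol — the datum the Fourier estimate bounds);
* §2 the model: **`effAction_counterQuadratic_sub_eq_diagQuad`** (`effAction_{normalCovariance Ψ_K}(𝒩_D) − 𝒩_D = Σ_{ks} (κ_D/(1+Ψ_Kκ_D) − κ_D) • ψ̂⁺ψ̂⁻`, `0 < β`;
  denominators by `one_add_uvSymbolCT_mul_ofReal_ne_zero`), `chainCoeff_eq_neg_sq` (`κ/(1+Ψκ) − κ = −κ²Ψ/(1+Ψκ)`), and the composed row identity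
  **`pinnedRow_two_chain_eq`**.

Identities only; the `ℓ¹` character sum of `−κ_D²Ψ̃/2` is left NAMED (its estimate — where the «VL-RESUM-WINDOW» smallness and the frequency-`ω₀` propagator's `ℓ¹` constant live —
is the next file).  Nothing asserts the (D) rows, (e), VL, K3 or superconductivity.  References: BGM 2006 §2.3 (2.20)–(2.24) [cite: BenfattoGiulianiMastropietro2006];
Feldman–Salmhofer–Trubowitz 1996 §1; Salmhofer 1999 §4.2 (4.16)–(4.20).
-/

noncomputable section

namespace Summit.HubbardSuperconductivity.HubbardSuperconductivity.Theorems.TwoVolumeDefect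

set_option linter.dupNamespace false -- summit = problem name (single-conjunct summit), D-0017

open Finset Complex Literature.MathematicalPhysics.QuantumLattice Literature.Probability.LatticeModels GrassmannAlgebra
open Summit.HubbardSuperconductivity.HubbardSuperconductivity.Theorems.KLRegimeSplit
open Summit.HubbardSuperconductivity.HubbardSuperconductivity.Theorems.KLProgrammeLegKernels
open Summit.HubbardSuperconductivity.HubbardSuperconductivity.Theorems.TwoLegFourier

variable {L M : ℕ} [NeZero L]

/-! ## §1 Generic diagonal quadratics: `(+,−)` kernel, raw two-leg position kernel, pinned rows -/

section Generic

omit [NeZero L] in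
/-- The delta determinant of the `(+,−)` strings at `(k,σ),(k′,σ′)` (two legs) and `(k″,s),(k″,s)`: nonzero only on the diagonal `(k,σ) = (k″,s) = (k′,σ′)`. [folklore] -/
theorem det_deltaMatrix_twoString_offDiag (k k' k'' : FreqMomentum L M) (σ σ' s : Fin 2) :
    (deltaMatrix ℂ (![((k, σ), 0), ((k', σ'), 1)] : Fin 2 → HubbardFieldIdx L M)
      (![((k'', s), 0), ((k'', s), 1)] : Fin 2 → HubbardFieldIdx L M)).det =
      if (k'', s) = (k, σ) ∧ (k'', s) = (k', σ') then 1 else 0 := by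
  rw [Matrix.det_fin_two]
  simp only [deltaMatrix_apply, Matrix.cons_val_zero, Matrix.cons_val_one, Prod.mk.injEq]
  by_cases h1 : k = k'' ∧ σ = s
  · by_cases h2 : k' = k'' ∧ σ' = s
    · obtain ⟨rfl, rfl⟩ := h1; obtain ⟨rfl, rfl⟩ := h2; simp
    · have h2' : ¬(k'' = k' ∧ s = σ') := fun hh => h2 ⟨hh.1.symm, hh.2.symm⟩
      simp [h2, h2']
  · have h1' : ¬(k'' = k ∧ s = σ) := fun hh => h1 ⟨hh.1.symm, hh.2.symm⟩
    simp [h1, h1']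

/-- **The `(+,−)` two-leg kernel of a diagonal quadratic** `Q = Σ_{ks} q ks • ψ̂⁺_{ks}ψ̂⁻_{ks}`: `kernel Q 2 ((k,σ,+),(k′,σ′,−)) = [ (k′,σ′) = (k,σ) ]·q(k,σ)·(2!)⁻¹`.
[cite: Salmhofer1999, §4.3 (4.95)] -/
theorem kernel_two_diagQuad_string (q : FreqMomentum L M × Fin 2 → ℂ) (k k' : FreqMomentum L M) (σ σ' : Fin 2) :
    kernel ℂ (∑ ks : FreqMomentum L M × Fin 2, q ks • (gen ℂ ((ks, 0) : HubbardFieldIdx L M) * gen ℂ ((ks, 1) : HubbardFieldIdx L M))) 2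
        (![((k, σ), 0), ((k', σ'), 1)] : Fin 2 → HubbardFieldIdx L M) =
      if (k', σ') = (k, σ) then q (k, σ) * (((2 : ℕ).factorial : ℚ)⁻¹ • (1 : ℂ)) else 0 := by
  rw [kernel_sum]
  have hgen : ∀ ks : FreqMomentum L M × Fin 2,
      gen ℂ ((ks, 0) : HubbardFieldIdx L M) * gen ℂ ((ks, 1) : HubbardFieldIdx L M) =
        genProd ℂ (![((ks.1, ks.2), 0), ((ks.1, ks.2), 1)] : Fin 2 → HubbardFieldIdx L M) := by
    intro ks
    rw [genProd_succ, genProd_succ, genProd_zero, mul_one]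
    rfl
  simp_rw [kernel_smul, hgen, kernel_genProd, det_deltaMatrix_twoString_offDiag]
  by_cases hk : (k', σ') = (k, σ)
  · rw [if_pos hk, hk, Finset.sum_eq_single (k, σ) (fun ks _ hks => by
      rw [if_neg (fun h => hks h.1), mul_zero, mul_zero]) (fun h => absurd (mem_univ _) h)]
    simp
  · rw [if_neg hk]
    refine sum_eq_zero fun ks _ => ?_
    rw [if_neg (fun h => hk (h.2.symm.trans h.1)), mul_zero, mul_zero]

/-- A diagonal quadratic has DIAGONAL `(+,−)` two-leg kernel (the hypothesis `hdiag` of k3c5-p2's `dualKernel_two_eq_of_diagonal`). -/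
theorem kernel_two_diagQuad_offDiag (q : FreqMomentum L M × Fin 2 → ℂ) (σ : Fin 2) (k k' : FreqMomentum L M) (hk : k' ≠ k) :
    kernel ℂ (∑ ks : FreqMomentum L M × Fin 2, q ks • (gen ℂ ((ks, 0) : HubbardFieldIdx L M) * gen ℂ ((ks, 1) : HubbardFieldIdx L M))) 2
        (![((k, σ), 0), ((k', σ), 1)] : Fin 2 → HubbardFieldIdx L M) = 0 := by
  rw [kernel_two_diagQuad_string, if_neg (fun h => hk (Prod.mk.inj h).1)]

/-- **The raw two-leg position kernel of a diagonal quadratic**: `W_σ(Q)(x₀,x₁) = Σ_k q(k,σ)·(2!)⁻¹·e^{iω_k(t₁−t₀)}·χ_{k⃗}(x⃗₁ − x⃗₀)`.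
[cite: BenfattoGiulianiMastropietro2006, §2.3 (2.17)] -/
theorem dualKernel_two_diagQuad (β : ℝ) (q : FreqMomentum L M × Fin 2 → ℂ) (σ : Fin 2) (x₀ x₁ : SpaceTimeIdx L M) :
    sectorisedKernel L M β (trivialMultiplier L M)
        (∑ ks : FreqMomentum L M × Fin 2, q ks • (gen ℂ ((ks, 0) : HubbardFieldIdx L M) * gen ℂ ((ks, 1) : HubbardFieldIdx L M))) 2
        (![((0, σ), 0), ((0, σ), 1)] : Fin 2 → SectorLeg 1) ![x₀, x₁] =
      ∑ k : FreqMomentum L M, q (k, σ) * (((2 : ℕ).factorial : ℚ)⁻¹ • (1 : ℂ)) *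
        (Complex.exp (((matsubaraFreq β M k.1 * (imagTime β M x₁.1 - imagTime β M x₀.1) : ℝ) : ℂ) * I) * torusChar k.2 (x₁.2 - x₀.2)) := by
  rw [dualKernel_two_eq_of_diagonal β _ σ (fun k k' hk => kernel_two_diagQuad_offDiag q σ k k' hk)]
  refine sum_congr rfl fun k _ => ?_
  rw [kernel_two_diagQuad_string, if_pos rfl]

/-- **THE PINNED RAW TWO-LEG ROW OF A DIAGONAL QUADRATIC IS THE `ℓ¹` CHARACTER SUM OF ITS SYMBOL**: at any pin `x₀`,
`Σ_{x₁} ‖W_σ(Q)(x₀,x₁)‖ = Σ_{x₁} ‖Σ_k q(k,σ)(2!)⁻¹ e^{iω_k(t₁−t₀)} χ_{k⃗}(x⃗₁−x⃗₀)‖`. -/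
theorem pinnedRow_two_diagQuad_eq (β : ℝ) (q : FreqMomentum L M × Fin 2 → ℂ) (σ : Fin 2) (x₀ : SpaceTimeIdx L M) :
    ∑ x₁ : SpaceTimeIdx L M, ‖sectorisedKernel L M β (trivialMultiplier L M)
        (∑ ks : FreqMomentum L M × Fin 2, q ks • (gen ℂ ((ks, 0) : HubbardFieldIdx L M) * gen ℂ ((ks, 1) : HubbardFieldIdx L M))) 2
        (![((0, σ), 0), ((0, σ), 1)] : Fin 2 → SectorLeg 1) ![x₀, x₁]‖ =
      ∑ x₁ : SpaceTimeIdx L M, ‖∑ k : FreqMomentum L M, q (k, σ) * (((2 : ℕ).factorial : ℚ)⁻¹ • (1 : ℂ)) *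
        (Complex.exp (((matsubaraFreq β M k.1 * (imagTime β M x₁.1 - imagTime β M x₀.1) : ℝ) : ℂ) * I) * torusChar k.2 (x₁.2 - x₀.2))‖ :=
  sum_congr rfl fun x₁ _ => by rw [dualKernel_two_diagQuad]

end Generic

/-! ## §2 The model: the chain part of the frame conversion is a diagonal quadratic with symbol `−κ_D²Ψ/(1+Ψκ_D)` -/

section Chain

variable [NeZero M] {β : ℝ} (hβ : 0 < β) (μ : ℝ) (K K₂ K₁ : TrigPolyC4v) (Λ : ℝ)
include hβ

/-- **The chain part is a diagonal quadratic**: for ANY frame `K` of the Gaussian step and the mismatch `D = K₂ ⊖ K₁`,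
`effAction (normalCovariance Ψ_K) 𝒩_D − 𝒩_D = Σ_{ks} (κ_D/(1 + Ψ_Kκ_D) − κ_D) • ψ̂⁺_{ks}ψ̂⁻_{ks}`, `κ_D(ks) = D(p_k⃗)/(βL²)`, `Ψ_K = uvSymbolCT … K Λ`
(`effAction_normalCovariance_diagQuadratic`; the denominators never vanish, `one_add_uvSymbolCT_mul_ofReal_ne_zero`). [cite: BenfattoGiulianiMastropietro2006, §2.3 (2.20)–(2.23)] -/
theorem effAction_counterQuadratic_sub_eq_diagQuad :
    effAction ℂ (normalCovariance L M (uvSymbolCT L M β μ K Λ)) (counterQuadratic L M β (fsub K₂ K₁)) - counterQuadratic L M β (fsub K₂ K₁) =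
      ∑ ks : FreqMomentum L M × Fin 2,
        ((((fsub K₂ K₁).eval (latticeMomentum L ks.1.2) / (β * (L : ℝ) ^ 2) : ℝ) : ℂ) /
              (1 + uvSymbolCT L M β μ K Λ ks * (((fsub K₂ K₁).eval (latticeMomentum L ks.1.2) / (β * (L : ℝ) ^ 2) : ℝ) : ℂ)) -
            (((fsub K₂ K₁).eval (latticeMomentum L ks.1.2) / (β * (L : ℝ) ^ 2) : ℝ) : ℂ)) •
          (gen ℂ ((ks, 0) : HubbardFieldIdx L M) * gen ℂ ((ks, 1) : HubbardFieldIdx L M)) := by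
  rw [counterQuadratic_eq_sum_smul,
    effAction_normalCovariance_diagQuadratic _ _ (fun ks => one_add_uvSymbolCT_mul_ofReal_ne_zero hβ μ K Λ _ ks), ← sum_sub_distrib]
  exact sum_congr rfl fun ks _ => by rw [sub_smul]

omit hβ in
/-- `κ/(1 + Ψκ) − κ = −κ²Ψ/(1 + Ψκ)` (`1 + Ψκ ≠ 0`): the chain part is SECOND ORDER in the mismatch. [folklore] -/
theorem chainCoeff_eq_neg_sq {Ψ κ : ℂ} (h : 1 + Ψ * κ ≠ 0) : κ / (1 + Ψ * κ) - κ = -(κ ^ 2 * Ψ / (1 + Ψ * κ)) := by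
  have key : κ / (1 + Ψ * κ) = κ - κ ^ 2 * Ψ / (1 + Ψ * κ) := by
    rw [eq_sub_iff_add_eq, ← add_div, div_eq_iff h]
    ring
  rw [key]
  ring

/-- **The pinned raw two-leg rows of the chain part, exactly**: at any pin `x₀` and spin `σ`,
`Σ_{x₁} ‖W_σ(effAction_{Ψ_K}(𝒩_D) − 𝒩_D)(x₀,x₁)‖ = Σ_{x₁} ‖Σ_k (κ_D/(1+Ψ_Kκ_D) − κ_D)(k,σ)·(2!)⁻¹·e^{iω_k(t₁−t₀)}·χ_{k⃗}(x⃗₁−x⃗₀)‖` — an `ℓ¹` character sum of a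
symbol of size `O(D²)`. [cite: BenfattoGiulianiMastropietro2006, §2.3 (2.20)–(2.24)] -/
theorem pinnedRow_two_chain_eq (σ : Fin 2) (x₀ : SpaceTimeIdx L M) :
    ∑ x₁ : SpaceTimeIdx L M, ‖sectorisedKernel L M β (trivialMultiplier L M)
        (effAction ℂ (normalCovariance L M (uvSymbolCT L M β μ K Λ)) (counterQuadratic L M β (fsub K₂ K₁)) - counterQuadratic L M β (fsub K₂ K₁)) 2
        (![((0, σ), 0), ((0, σ), 1)] : Fin 2 → SectorLeg 1) ![x₀, x₁]‖ =
      ∑ x₁ : SpaceTimeIdx L M, ‖∑ k : FreqMomentum L M,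
        ((((fsub K₂ K₁).eval (latticeMomentum L k.2) / (β * (L : ℝ) ^ 2) : ℝ) : ℂ) /
              (1 + uvSymbolCT L M β μ K Λ (k, σ) * (((fsub K₂ K₁).eval (latticeMomentum L k.2) / (β * (L : ℝ) ^ 2) : ℝ) : ℂ)) -
            (((fsub K₂ K₁).eval (latticeMomentum L k.2) / (β * (L : ℝ) ^ 2) : ℝ) : ℂ)) * (((2 : ℕ).factorial : ℚ)⁻¹ • (1 : ℂ)) *
          (Complex.exp (((matsubaraFreq β M k.1 * (imagTime β M x₁.1 - imagTime β M x₀.1) : ℝ) : ℂ) * I) * torusChar k.2 (x₁.2 - x₀.2))‖ := by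
  rw [effAction_counterQuadratic_sub_eq_diagQuad hβ μ K K₂ K₁ Λ]
  exact pinnedRow_two_diagQuad_eq β _ σ x₀

end Chain

end Summit.HubbardSuperconductivity.HubbardSuperconductivity.Theorems.TwoVolumeDefect

end
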